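import Summits.CriticalPhenomena.SAWScalingLimit.Theorems.SAWTotalPositivityBoundaryTP2Defs
import Summits.CriticalPhenomena.SAWScalingLimit.Theorems.SAWTotalPositivityBoundaryTP2Kernel
import Summits.CriticalPhenomena.SAWScalingLimit.Theorems.SAWTotalPositivityBoundaryTP2Symmetry
import Summits.CriticalPhenomena.SAWScalingLimit.Theorems.SAWTotalPositivityBoundaryTP2FirstStep
import Summits.CriticalPhenomena.SAWScalingLimit.Theorems.SAWTotalPositivityBoundaryTP2Avoid
import Summits.CriticalPhenomena.SAWScalingLimit.Theorems.SAWTotalPositivityBoundaryTP2SquareGadget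
import Summits.CriticalPhenomena.SAWScalingLimit.Theorems.EdgeOfPositivity.Negative.EdgeOfPositivityRectDomain
import HarnessLib

/-!
# Crux `BoundaryTP2` (stmt-CriticalPhenomena-7115), line `Sketch`: kernels of the ladder into its end column

Helper identities for the tool stub `stub_ladderKernels_interior` (all two-point kernels of the ladders
`R_n = discreteDomainGraph (rectDomain n 1) 1`, sites `{0..n} × {0,1}`), everything proved:

* coordinates on the ladder (`ladderInt_adj_iff`, `ladderInt_eq_st_iff`), the neighbourhoods of the
  sites of the last column and the graph identity `(R_{n+1} - (n+1,σ)) - (n+1,1-σ) = R_n`;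
* the **last-column recursion** from an arbitrary start `(i,ρ)`, `i ≤ n`:
  `Z_{R_{n+1}}((i,ρ),(n+1,σ)) = x Z_{R_n}((i,ρ),(n,σ)) + x² Z_{R_n}((i,ρ),(n,1-σ))` (`ladderInt_rec`);
* the **end rung** `Z_{R_n}((n,σ),(n,1-σ)) = x + E_n`, `E_n = Σ_{d<n} x^{2d+3}` (the rung itself, or a
  U-turn excursion `(n,σ) → (n-d-1,σ) → (n-d-1,1-σ) → (n,1-σ)` of length `2d+3`) (`ladderInt_rungEnd`);
* the **end-column kernels** from an interior column: for `i ≤ i+m = n`,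
  `Z_{R_n}((i,ρ),(n,σ)) = x^m (F^{ε}_{m+1} + E_i F^{-ε}_m)`, `F^{ε}_k = ((1+x)^k + ε (1-x)^k)/2`,
  `ε = +1` if `ρ = σ`, `-1` otherwise (`ladderInt_endKernel`): a monotone zigzag preceded by an
  optional U-turn excursion to the left of column `i`.
-/

noncomputable section

namespace Summit.CriticalPhenomena.SAWScalingLimit.Theorems.BoundaryTP2

open Literature.Probability.LatticeModels Literature.Probability.RandomPlanarGeometry
open Summit.CriticalPhenomena.SAWScalingLimit.Theorems.EdgeOfPositivity.Negative
open scoped ENNReal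

/-! ## Coordinates on the ladder -/

/-- Adjacency in `ℤ²` in coordinates: the sites agree in one coordinate and differ by `1` in the
other. [folklore] -/
private theorem ladderInt_zd_adj_iff (u v : Site 2) :
    (zdGraph 2).Adj u v ↔
      ((v 0 = u 0 + 1 ∨ u 0 = v 0 + 1) ∧ v 1 = u 1) ∨
        ((v 1 = u 1 + 1 ∨ u 1 = v 1 + 1) ∧ v 0 = u 0) := by
  rw [zdGraph_adj_iff, Fin.exists_fin_two]
  simp only [funext_iff, Fin.forall_fin_two, Pi.add_apply, Pi.single_eq_same,
    Pi.single_eq_of_ne (one_ne_zero : (1 : Fin 2) ≠ 0),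
    Pi.single_eq_of_ne (zero_ne_one : (0 : Fin 2) ≠ 1), add_zero]
  omega

/-- A site equals `st a b` iff its two coordinates are `a` and `b`. [folklore] -/
theorem ladderInt_eq_st_iff (v : Site 2) (a b : ℤ) : v = st a b ↔ v 0 = a ∧ v 1 = b := by
  constructor
  · rintro rfl
    exact ⟨rfl, rfl⟩
  · rintro ⟨h0, h1⟩
    rw [← st_eta v, h0, h1]

/-- Adjacency of the ladder `{0..a} × {0,1}` in coordinates. [folklore] -/
theorem ladderInt_adj_iff (a : ℕ) (u v : Site 2) :
    (discreteDomainGraph (rectDomain a 1) 1).Adj u v ↔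
      (((v 0 = u 0 + 1 ∨ u 0 = v 0 + 1) ∧ v 1 = u 1) ∨
          ((v 1 = u 1 + 1 ∨ u 1 = v 1 + 1) ∧ v 0 = u 0)) ∧
        ((0 ≤ u 0 ∧ u 0 ≤ a) ∧ (0 ≤ u 1 ∧ u 1 ≤ 1)) ∧
          ((0 ≤ v 0 ∧ v 0 ≤ a) ∧ (0 ≤ v 1 ∧ v 1 ≤ 1)) := by
  rw [adj_rect_iff, ladderInt_zd_adj_iff, mem_rectSites_iff, mem_rectSites_iff, Nat.cast_one]

/-! ## The last column of the ladder -/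

/-- In `R_0` (the single edge `(0,0) ∼ (0,1)`) the only neighbour of `(0,σ)` is `(0,1-σ)`. [folklore] -/
private theorem ladderInt_base_neighborSet (σ : ℤ) (hσ : σ = 0 ∨ σ = 1) :
    (discreteDomainGraph (rectDomain 0 1) 1).neighborSet (st 0 σ) = {st 0 (1 - σ)} := by
  ext v
  rw [SimpleGraph.mem_neighborSet, ladderInt_adj_iff, Set.mem_singleton_iff, ladderInt_eq_st_iff]
  simp only [st_zero, st_one, Nat.cast_zero]
  omega

/-- In `R_{n+1}` the corner `(n+1,σ)` has exactly the two neighbours `(n,σ)` and `(n+1,1-σ)`.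
[folklore] -/
private theorem ladderInt_corner_neighborSet (n : ℕ) (σ : ℤ) (hσ : σ = 0 ∨ σ = 1) :
    (discreteDomainGraph (rectDomain (n + 1) 1) 1).neighborSet (st (n + 1 : ℕ) σ) =
      {st n σ, st (n + 1 : ℕ) (1 - σ)} := by
  ext v
  rw [SimpleGraph.mem_neighborSet, ladderInt_adj_iff, Set.mem_insert_iff, Set.mem_singleton_iff,
    ladderInt_eq_st_iff, ladderInt_eq_st_iff]
  simp only [st_zero, st_one]
  push_cast
  omega

/-- In `R_{n+1} - (n+1,σ)` the other site `(n+1,1-σ)` of the last column is a leaf: its only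
neighbour is `(n,1-σ)`. [folklore] -/
theorem ladderInt_hanging_neighborSet (n : ℕ) (σ : ℤ) (hσ : σ = 0 ∨ σ = 1) :
    ((discreteDomainGraph (rectDomain (n + 1) 1) 1).deleteEdges
        ((discreteDomainGraph (rectDomain (n + 1) 1) 1).incidenceSet (st (n + 1 : ℕ) σ))).neighborSet
        (st (n + 1 : ℕ) (1 - σ)) = {st n (1 - σ)} := by
  ext v
  rw [SimpleGraph.mem_neighborSet, deleteEdges_incidenceSet_adj, ladderInt_adj_iff,
    Set.mem_singleton_iff, Ne, Ne, ladderInt_eq_st_iff, ladderInt_eq_st_iff, ladderInt_eq_st_iff]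
  simp only [st_zero, st_one]
  push_cast
  omega

/-- Deleting both sites of the last column of `R_{n+1}` leaves `R_n`:
`(R_{n+1} - (n+1,σ)) - (n+1,1-σ) = R_n` as simple graphs on `Site 2`. [folklore] -/
theorem ladderInt_delete_lastColumn (n : ℕ) (σ : ℤ) (hσ : σ = 0 ∨ σ = 1) :
    ((discreteDomainGraph (rectDomain (n + 1) 1) 1).deleteEdges
        ((discreteDomainGraph (rectDomain (n + 1) 1) 1).incidenceSet (st (n + 1 : ℕ) σ))).deleteEdges
      (((discreteDomainGraph (rectDomain (n + 1) 1) 1).deleteEdges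
        ((discreteDomainGraph (rectDomain (n + 1) 1) 1).incidenceSet (st (n + 1 : ℕ) σ))).incidenceSet
          (st (n + 1 : ℕ) (1 - σ))) =
      discreteDomainGraph (rectDomain n 1) 1 := by
  ext u v
  rw [deleteEdges_incidenceSet_adj, deleteEdges_incidenceSet_adj, ladderInt_adj_iff,
    ladderInt_adj_iff, Ne, Ne, Ne, Ne, ladderInt_eq_st_iff, ladderInt_eq_st_iff, ladderInt_eq_st_iff,
    ladderInt_eq_st_iff]
  push_cast
  omega

/-! ## The last-column recursion from an arbitrary start -/

/-- **Last-column recursion** from an arbitrary start `(i,ρ)` strictly left of the last column: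
`Z_{R_{n+1}}((i,ρ),(n+1,σ)) = x Z_{R_n}((i,ρ),(n,σ)) + x² Z_{R_n}((i,ρ),(n,1-σ))` (`i ≤ n`, `x ≥ 0`,
`σ ∈ {0,1}`): reverse the paths, first step at the corner `(n+1,σ)` (neighbours `(n,σ)`, `(n+1,1-σ)`);
in `R_{n+1} - (n+1,σ)` the site `(n+1,1-σ)` is a leaf on `(n,1-σ)`, never visited by the paths from
`(n,σ)` and left immediately by the paths from itself; what remains is `R_n`. [folklore] -/
theorem ladderInt_rec (n i : ℕ) (hi : i ≤ n) {x : ℝ} (hx : 0 ≤ x) (ρ σ : ℤ) (hσ : σ = 0 ∨ σ = 1) :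
    pathKernel (discreteDomainGraph (rectDomain (n + 1) 1) 1) x (st i ρ) (st (n + 1 : ℕ) σ) =
      ENNReal.ofReal x *
        (pathKernel (discreteDomainGraph (rectDomain n 1) 1) x (st i ρ) (st n σ) +
          ENNReal.ofReal x *
            pathKernel (discreteDomainGraph (rectDomain n 1) 1) x (st i ρ) (st n (1 - σ))) := by
  classical
  set R := discreteDomainGraph (rectDomain (n + 1) 1) 1
  have hca : st (n + 1 : ℕ) σ ≠ st i ρ := by
    rw [Ne, ladderInt_eq_st_iff, st_zero]; push_cast; omega
  have hvv : st (n : ℤ) σ ≠ st (n + 1 : ℕ) (1 - σ) := by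
    rw [Ne, ladderInt_eq_st_iff, st_zero]; push_cast; omega
  have hc'a : st (n + 1 : ℕ) (1 - σ) ≠ st i ρ := by
    rw [Ne, ladderInt_eq_st_iff, st_zero]; push_cast; omega
  have hN : R.neighborSet (st (n + 1 : ℕ) σ) = {st n σ, st (n + 1 : ℕ) (1 - σ)} :=
    ladderInt_corner_neighborSet n σ hσ
  rw [pathKernel_comm R x (st i ρ) (st (n + 1 : ℕ) σ), pathKernel_firstStep_pair R x hx hca hvv hN]
  set R' := R.deleteEdges (R.incidenceSet (st (n + 1 : ℕ) σ))
  have hN' : R'.neighborSet (st (n + 1 : ℕ) (1 - σ)) = {st n (1 - σ)} :=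
    ladderInt_hanging_neighborSet n σ hσ
  have hleaf : ∀ z, R'.Adj (st (n + 1 : ℕ) (1 - σ)) z → z = st n (1 - σ) := fun z hz => by
    have hz' : z ∈ R'.neighborSet (st (n + 1 : ℕ) (1 - σ)) := hz
    rwa [hN', Set.mem_singleton_iff] at hz'
  have hRn : R'.deleteEdges (R'.incidenceSet (st (n + 1 : ℕ) (1 - σ))) =
      discreteDomainGraph (rectDomain n 1) 1 :=
    ladderInt_delete_lastColumn n σ hσ
  rw [pathKernel_eq_deleteVert_of_leaf R' x hleaf hvv hc'a.symm, hRn,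
    pathKernel_firstStep_single R' x hx hc'a hN', hRn,
    pathKernel_comm _ x (st (n : ℤ) σ) (st i ρ), pathKernel_comm _ x (st (n : ℤ) (1 - σ)) (st i ρ)]

/-! ## The end rung -/

/-- `x · (x · E_n) = Σ_{d<n} x^{2(d+1)+3}`: shifting the excursion sum. [folklore] -/
theorem ladderInt_excursion_shift (x : ℝ) (n : ℕ) :
    x * (x * ∑ d ∈ Finset.range n, x ^ (2 * d + 3)) = ∑ d ∈ Finset.range n, x ^ (2 * (d + 1) + 3) := by
  rw [← mul_assoc, Finset.mul_sum]
  refine Finset.sum_congr rfl fun d _ => ?_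
  ring

/-- **The end rung.** On `R_n` the kernel between the two sites of the last column is
`Z_{R_n}((n,σ),(n,1-σ)) = x + Σ_{d<n} x^{2d+3}`: first step at the corner `(n+1,σ)` of `R_{n+1}`
(neighbours `(n,σ)` and the target), `U_{n+1} = x (1 + x U_n)`, `U_0 = x`. [folklore] -/
theorem ladderInt_rungEnd (n : ℕ) {x : ℝ} (hx : 0 ≤ x) (σ τ : ℤ) (hσ : σ = 0 ∨ σ = 1) (hτ : τ = 1 - σ) :
    pathKernel (discreteDomainGraph (rectDomain n 1) 1) x (st n σ) (st n τ) =
      ENNReal.ofReal (x + ∑ d ∈ Finset.range n, x ^ (2 * d + 3)) := by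
  classical
  subst hτ
  induction n generalizing σ with
  | zero =>
    have hab : st 0 σ ≠ st 0 (1 - σ) := by
      rw [Ne, ladderInt_eq_st_iff, st_zero, st_one]; omega
    rw [Nat.cast_zero, pathKernel_firstStep_single _ x hx hab (ladderInt_base_neighborSet σ hσ),
      pathKernel_self, mul_one, Finset.sum_range_zero, add_zero]
  | succ n ih =>
    set R := discreteDomainGraph (rectDomain (n + 1) 1) 1
    have hab : st (n + 1 : ℕ) σ ≠ st (n + 1 : ℕ) (1 - σ) := by
      rw [Ne, ladderInt_eq_st_iff, st_one]; omega
    have hvv : st (n : ℤ) σ ≠ st (n + 1 : ℕ) (1 - σ) := by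
      rw [Ne, ladderInt_eq_st_iff, st_zero]; push_cast; omega
    have hc'v : st (n + 1 : ℕ) (1 - σ) ≠ st n σ := by
      rw [Ne, ladderInt_eq_st_iff, st_zero]; push_cast; omega
    have hN : R.neighborSet (st (n + 1 : ℕ) σ) = {st n σ, st (n + 1 : ℕ) (1 - σ)} :=
      ladderInt_corner_neighborSet n σ hσ
    rw [pathKernel_firstStep_pair R x hx hab hvv hN, pathKernel_self]
    set R' := R.deleteEdges (R.incidenceSet (st (n + 1 : ℕ) σ))
    have hN' : R'.neighborSet (st (n + 1 : ℕ) (1 - σ)) = {st n (1 - σ)} :=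
      ladderInt_hanging_neighborSet n σ hσ
    have hRn : R'.deleteEdges (R'.incidenceSet (st (n + 1 : ℕ) (1 - σ))) =
        discreteDomainGraph (rectDomain n 1) 1 :=
      ladderInt_delete_lastColumn n σ hσ
    have h1 : (1 : ℤ) - (1 - σ) = σ := by ring
    have ih' := ih (1 - σ) (by omega)
    rw [h1] at ih'
    rw [pathKernel_comm R' x (st (n : ℤ) σ), pathKernel_firstStep_single R' x hx hc'v hN', hRn, ih']
    have hE : 0 ≤ x + ∑ d ∈ Finset.range n, x ^ (2 * d + 3) :=
      add_nonneg hx (Finset.sum_nonneg fun d _ => pow_nonneg hx _)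
    rw [← ENNReal.ofReal_mul hx, ← ENNReal.ofReal_one, ← ENNReal.ofReal_add (mul_nonneg hx hE)
      zero_le_one, ← ENNReal.ofReal_mul hx]
    congr 1
    rw [Finset.sum_range_succ', ← ladderInt_excursion_shift]
    ring

/-! ## The end-column kernels from an interior column -/

/-- For `x ≥ 0`, `|(1 - x)^k| ≤ (1 + x)^k`. [folklore] -/
private theorem ladderInt_abs_one_sub_pow_le {x : ℝ} (hx : 0 ≤ x) (k : ℕ) :
    |(1 - x) ^ k| ≤ (1 + x) ^ k := by
  rw [abs_pow]
  exact pow_le_pow_left₀ (abs_nonneg _) (abs_le.2 ⟨by linarith, by linarith⟩) k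

/-- The zigzag generating functions `F^{ε}_k = ((1+x)^k + ε (1-x)^k)/2` are nonnegative for
`x ≥ 0`, `ε = ±1`. [folklore] -/
theorem ladderInt_zigzag_nonneg {x : ℝ} (hx : 0 ≤ x) (k : ℕ) {ε : ℝ} (hε : ε = 1 ∨ ε = -1) :
    0 ≤ ((1 + x) ^ k + ε * (1 - x) ^ k) / 2 := by
  have h := abs_le.1 (ladderInt_abs_one_sub_pow_le hx k)
  have h2 : 0 ≤ (1 + x) ^ k + ε * (1 - x) ^ k := by
    rcases hε with rfl | rfl <;> linarith [h.1, h.2]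
  exact div_nonneg h2 zero_le_two

/-- The closed form of the end-column kernels is nonnegative for `x ≥ 0`. [folklore] -/
theorem ladderInt_endForm_nonneg {x : ℝ} (hx : 0 ≤ x) (m i : ℕ) {ε : ℝ} (hε : ε = 1 ∨ ε = -1) :
    0 ≤ x ^ m * (((1 + x) ^ (m + 1) + ε * (1 - x) ^ (m + 1)) / 2 +
      (∑ d ∈ Finset.range i, x ^ (2 * d + 3)) * (((1 + x) ^ m - ε * (1 - x) ^ m) / 2)) := by
  have hA := ladderInt_zigzag_nonneg hx (m + 1) hε
  have hB : 0 ≤ ((1 + x) ^ m - ε * (1 - x) ^ m) / 2 := by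
    have h := ladderInt_zigzag_nonneg hx m (ε := -ε) (by rcases hε with rfl | rfl <;> norm_num)
    have he : (1 + x) ^ m - ε * (1 - x) ^ m = (1 + x) ^ m + -ε * (1 - x) ^ m := by ring
    rwa [he]
  have hE : 0 ≤ ∑ d ∈ Finset.range i, x ^ (2 * d + 3) := Finset.sum_nonneg fun d _ => pow_nonneg hx _
  exact mul_nonneg (pow_nonneg hx m) (add_nonneg hA (mul_nonneg hE hB))

/-- **End-column kernels from an interior column.** For `x ≥ 0`, `ρ, σ ∈ {0,1}` and `i, m : ℕ`,
on the ladder `R_{i+m}` the kernel from `(i,ρ)` to the end site `(i+m,σ)` is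
`x^m (F^{ε}_{m+1} + E_i F^{-ε}_m)` with `F^{ε}_k = ((1+x)^k + ε(1-x)^k)/2`, `E_i = Σ_{d<i} x^{2d+3}`,
`ε = +1` if `ρ = σ` and `-1` otherwise: induction on `m` by the last-column recursion `ladderInt_rec`,
the base `m = 0` being the trivial kernel `1` (`ρ = σ`) or the end rung `x + E_i` (`ρ ≠ σ`).
[folklore] -/
theorem ladderInt_endKernel (i m : ℕ) {x : ℝ} (hx : 0 ≤ x) (ρ σ : ℤ) (hρ : ρ = 0 ∨ ρ = 1)
    (hσ : σ = 0 ∨ σ = 1) :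
    pathKernel (discreteDomainGraph (rectDomain (i + m) 1) 1) x (st i ρ) (st (i + m : ℕ) σ) =
      ENNReal.ofReal (x ^ m * (((1 + x) ^ (m + 1) + (if ρ = σ then 1 else -1) * (1 - x) ^ (m + 1)) / 2 +
        (∑ d ∈ Finset.range i, x ^ (2 * d + 3)) *
          (((1 + x) ^ m - (if ρ = σ then 1 else -1) * (1 - x) ^ m) / 2))) := by
  induction m generalizing σ with
  | zero =>
    rw [Nat.add_zero]
    rcases eq_or_ne ρ σ with rfl | hne
    · rw [pathKernel_self, if_pos rfl,
        show x ^ 0 * (((1 + x) ^ (0 + 1) + 1 * (1 - x) ^ (0 + 1)) / 2 +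
          (∑ d ∈ Finset.range i, x ^ (2 * d + 3)) * (((1 + x) ^ 0 - 1 * (1 - x) ^ 0) / 2)) = 1 by ring,
        ENNReal.ofReal_one]
    · rw [if_neg hne, ladderInt_rungEnd i hx ρ σ hρ (by omega)]
      congr 1
      ring
  | succ m ih =>
    rw [← Nat.add_assoc, ladderInt_rec (i + m) i (Nat.le_add_right i m) hx ρ σ hσ, ih σ hσ,
      ih (1 - σ) (by omega)]
    have hA := ladderInt_endForm_nonneg hx m i (ite_eq_or_eq (P := ρ = σ) (1 : ℝ) (-1))
    have hB := ladderInt_endForm_nonneg hx m i (ite_eq_or_eq (P := ρ = 1 - σ) (1 : ℝ) (-1))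
    rw [← ENNReal.ofReal_mul hx, ← ENNReal.ofReal_add hA (mul_nonneg hx hB), ← ENNReal.ofReal_mul hx]
    congr 1
    have hε : (if ρ = 1 - σ then (1 : ℝ) else -1) = -(if ρ = σ then (1 : ℝ) else -1) := by
      rcases hρ with rfl | rfl <;> rcases hσ with rfl | rfl <;> norm_num
    rw [hε]
    ring

end Summit.CriticalPhenomena.SAWScalingLimit.Theorems.BoundaryTP2
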